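import Summits.QuantumFields.YangMills.Theorems.BalabanLadderIRColdPurityDobrushinWindow
import Summits.QuantumFields.YangMills.Theorems.BalabanLadderIRCouplingDerivative
import HarnessLib

/-!
# Crux `IR` (stmt-QuantumFields-19354), cold-purity currency: the COLD-PURITY CORNER AT THE DOBRUSHIN DOOR —
# `δᶜ_β(L) ≤ (4/9) · L³⌊L/4⌋ · 2^{−⌊(⌊L/4⌋−3)/2⌋}` for `216 · N · β ≤ 1`, every `L ≥ 20`, every compact group

Helper file (`--supports stmt-QuantumFields-19354`, helper class; no registered stub is claimed) of the pooled IR prover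
`ym-ir-line-pool-p3` (g6): the assembly «J-A′» of `Cruxes/IR/PURITY-CORNER-TRANSPORT-idea3g13.md` (FINITE-BOX-PURITY §9
row (i-f), tier A), on top of `BalabanLadderIRColdPurityDobrushinWindow.lean` (one-point torus-size difference
`≤ 8N · 2^{−k}` inside the door; action expectation as a plaquette sum; `2 : 1` time covering) and
`BalabanLadderIRCouplingDerivative.lean` (`d/dβ log(Z_{2t}/Z_t²)`):

* `hasDerivAt_negLogColdRatio` — `d/dβ F_β = ⟨S⟩_{β; L³×2t} − 2⟨S⟩_{β; L³×t}`, `F_β := −log(Z_β(L³×2t)/Z_β(L³×t)²)`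
  (`= −log(1 − δᶜ_β(L))` for `t = ⌊L/4⌋`), read with `finTorusExpectation`;
* `abs_actionDefect_le` — inside the door, `|⟨S⟩_{2t} − 2⟨S⟩_t| ≤ 6 · L³ · 2t · 8N · 2^{−k}` (`2k + 2 < L`, `2k + 2 < t`):
  pair each plaquette of the long torus with its image in the short one and apply the one-point bound;
* `negLogColdRatio_le` — `F_β ≤ (4/9) · L³ t · 2^{−k}` for `0 ≤ β`, `216 N β ≤ 1` (mean value inequality from `F_0 = 0`;
  `96 N β ≤ 4/9`);
* **`coldDefect_le_of_dobrushinTV`** — `δᶜ_β(L) ≤ (4/9) · L³⌊L/4⌋ · 2^{−⌊(⌊L/4⌋−3)/2⌋}` (`δᶜ = 1 − e^{−F} ≤ F`), every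
  compact metrisable `G`, every lattice representation, `0 ≤ β ≤ 1/(216 N)`, `L ≥ 20`;
* **`coldExitAt_corner_of_dobrushinTV`** — hence for every `θ > 0` a GROUP-FREE `L₀` with `δᶜ_β(L) ≤ θ` for all
  `L ≥ L₀`, all `G`, `r`, `0 ≤ β ≤ 1/(216 N)` (the shape of `ColdPurityBridge.coldExit_uniform_of_strongCoupling` with
  `strongCouplingRadius` replaced by the Dobrushin door — for `SU(2)`: `β_W ≤ 1/216 ≈ 4.6·10⁻³` instead of
  `≈ 2.6·10⁻⁷` — and ALL sides `L ≥ L₀` instead of `L = 8k`).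

Spot values of the majorant (arithmetic): `L = 292: 0.0235`, `300: 0.0131`, `320: 4.2·10⁻³`, `400: 1.0·10⁻⁵`; it is
`≤ 1/24` for every `L ≥ 292` (ideator's table, tier A).

HONEST FRAMING.  A strong-coupling FORMAT rung (group-blind: it holds verbatim for `U(1)`), the opposite corner to
`ColdExitAt θ`'s `∀ β ≥ β₁ ∃ L`; it certifies the integrand's torus-size dependence inside the door and nothing at weak
coupling.  Nothing here proves `BalabanLadder.IR` (0/1), a lattice mass gap, confinement, or the Yang–Mills mass gap
(Clay); R4 closes only the conditional finite-𝕋⁴ rung `BalabanLadder.UV`.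
-/

set_option autoImplicit false

noncomputable section

namespace Summit.QuantumFields.YangMills.Cruxes.IR.ColdPurityDobrushin

open MeasureTheory Filter Topology Finset
open Literature.MathematicalPhysics.QuantumFieldTheory hiding ZdEdge
open Literature.MathematicalPhysics.QuantumLattice
open Summit.QuantumFields.YangMills.Cruxes.IR.ColdPurityBridge (coldDefect)

/-! ## §3 The coupling derivative of `F = −log(1 − δᶜ)`, its bound inside the door, and the assembly -/

section Assembly

variable {G : Type} [Group G] [TopologicalSpace G] [IsTopologicalGroup G] [CompactSpace G]
  [MeasurableSpace G] [BorelSpace G]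

/-- The un-normalised coupling derivative of the partition function is `−Z · ⟨S⟩`:
`(∫ −S e^{−βS}) / Z = −⟨S⟩`. -/
theorem integral_neg_action_div_eq (r : LatticeRep G) (β : ℝ) (L T : ℕ) :
    (∫ U, -finTorusWilsonAction r.ρ U * Real.exp (-(β * finTorusWilsonAction r.ρ U))
        ∂(Measure.pi fun _ : FinTorusSite L L L T × Fin 4 => haarProbability G)) /
        wilsonFinTorusPartition r.ρ β L L L T =
      -finTorusExpectation r.ρ β (finTorusWilsonAction (n₀ := L) (n₁ := L) (n₂ := L) (n₃ := T) r.ρ) := by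
  rw [finTorusExpectation_eq_div, ← neg_div, ← integral_neg]
  congr 1
  refine integral_congr_ae (ae_of_all _ fun U => ?_)
  simp only [finTorusTwistedWeight_one, finTorusWilsonAction, neg_mul]

/-- **`d/dβ (−log(Z_β(L³×2t)/Z_β(L³×t)²)) = ⟨S⟩_{β;L³×2t} − 2⟨S⟩_{β;L³×t}`** (the action-additivity defect under time
doubling; `CouplingAxis.hasDerivAt_log_coldRatio` read with `finTorusExpectation`). -/
theorem hasDerivAt_negLogColdRatio (r : LatticeRep G) (L t : ℕ) (β₀ : ℝ) :
    HasDerivAt (fun β : ℝ => -Real.log (wilsonFinTorusPartition r.ρ β L L L (2 * t) /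
        wilsonFinTorusPartition r.ρ β L L L t ^ 2))
      (finTorusExpectation r.ρ β₀ (finTorusWilsonAction (n₀ := L) (n₁ := L) (n₂ := L) (n₃ := 2 * t) r.ρ) -
        2 * finTorusExpectation r.ρ β₀ (finTorusWilsonAction (n₀ := L) (n₁ := L) (n₂ := L) (n₃ := t) r.ρ)) β₀ := by
  have h := (CouplingAxis.hasDerivAt_log_coldRatio r L t β₀).neg
  rw [integral_neg_action_div_eq, integral_neg_action_div_eq] at h
  exact h.congr_deriv (by ring)

/-- **The coupling derivative inside the door**: for `216 · N · |β| ≤ 1` and `2k + 2 < L`, `2k + 2 < t`,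
`|⟨S⟩_{L³×2t} − 2⟨S⟩_{L³×t}| ≤ (L·L·L·2t) · 6 · 8N · 2^{−k}` — pair each plaquette of the long torus with its image
in the short one (`sum_comp_timeDouble`) and bound each pair by `abs_plaquetteActionObs_sub_le_of_dobrushin`. -/
theorem abs_actionDefect_le (r : LatticeRep G) {β : ℝ} (hβ : 216 * (r.N : ℝ) * |β| ≤ 1) {L t k : ℕ} [NeZero L]
    [NeZero t] [NeZero (2 * t)] (hL : 2 * k + 2 < L) (ht : 2 * k + 2 < t) :
    |finTorusExpectation r.ρ β (finTorusWilsonAction (n₀ := L) (n₁ := L) (n₂ := L) (n₃ := 2 * t) r.ρ) -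
        2 * finTorusExpectation r.ρ β (finTorusWilsonAction (n₀ := L) (n₁ := L) (n₂ := L) (n₃ := t) r.ρ)| ≤
      ((L * L * L * (2 * t) : ℕ) : ℝ) * 6 * (8 * r.N * (1 / 2 : ℝ) ^ k) := by
  have h2t : 2 * k + 2 < 2 * t := by omega
  rw [finTorusExpectation_action_eq_sum, finTorusExpectation_action_eq_sum,
    ← sum_comp_timeDouble (fun x' : FinTorusSite L L L t => ∑ q : {q : Fin 4 × Fin 4 // q.1 < q.2},
      finTorusExpectation r.ρ β (fun V : FinTorusSite L L L t × Fin 4 → G =>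
        (r.N : ℝ) - (r.ρ (finTorusPlaquette V x' q.1.1 q.1.2)).trace.re)),
    ← Finset.sum_sub_distrib]
  simp only [← Finset.sum_sub_distrib]
  -- each pair of plaquette expectations differs by at most `8N 2^{-k}`
  have hpair : ∀ (x : FinTorusSite L L L (2 * t)) (q : {q : Fin 4 × Fin 4 // q.1 < q.2}),
      |finTorusExpectation r.ρ β (fun V : FinTorusSite L L L (2 * t) × Fin 4 → G =>
            (r.N : ℝ) - (r.ρ (finTorusPlaquette V x q.1.1 q.1.2)).trace.re) -
          finTorusExpectation r.ρ β (fun V : FinTorusSite L L L t × Fin 4 → G =>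
            (r.N : ℝ) - (r.ρ (finTorusPlaquette V (finTorusProjSite L t (finTorusRepr x)) q.1.1 q.1.2)).trace.re)| ≤
        8 * r.N * (1 / 2 : ℝ) ^ k := by
    intro x q
    have h := abs_plaquetteActionObs_sub_le_of_dobrushin r hβ (T₁ := 2 * t) (T₂ := t) hL h2t ht
      ((finTorusRepr x, q) : ZdPlaquette 4)
    simpa only [plaquetteActionObs_finTorusLift, finTorusProjSite_finTorusRepr] using h
  calc |∑ x : FinTorusSite L L L (2 * t), ∑ q : {q : Fin 4 × Fin 4 // q.1 < q.2},
          (finTorusExpectation r.ρ β (fun V : FinTorusSite L L L (2 * t) × Fin 4 → G =>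
              (r.N : ℝ) - (r.ρ (finTorusPlaquette V x q.1.1 q.1.2)).trace.re) -
            finTorusExpectation r.ρ β (fun V : FinTorusSite L L L t × Fin 4 → G =>
              (r.N : ℝ) - (r.ρ (finTorusPlaquette V (finTorusProjSite L t (finTorusRepr x)) q.1.1 q.1.2)).trace.re))|
      ≤ ∑ x : FinTorusSite L L L (2 * t), ∑ _q : {q : Fin 4 × Fin 4 // q.1 < q.2}, 8 * r.N * (1 / 2 : ℝ) ^ k := by
        refine (Finset.abs_sum_le_sum_abs _ _).trans (Finset.sum_le_sum fun x _ => ?_)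
        exact (Finset.abs_sum_le_sum_abs _ _).trans (Finset.sum_le_sum fun q _ => hpair x q)
    _ = ((L * L * L * (2 * t) : ℕ) : ℝ) * 6 * (8 * r.N * (1 / 2 : ℝ) ^ k) := by
        have hplanes : Fintype.card {q : Fin 4 × Fin 4 // q.1 < q.2} = 6 := by decide
        simp only [Finset.sum_const, Finset.card_univ, hplanes, nsmul_eq_mul, Fintype.card_prod,
          Fintype.card_fin]
        push_cast
        ring

/-- At `β = 0` the Wilson partition function is `1` (product of probability measures). -/
theorem wilsonFinTorusPartition_zero (r : LatticeRep G) (n₀ n₁ n₂ n₃ : ℕ) :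
    wilsonFinTorusPartition r.ρ 0 n₀ n₁ n₂ n₃ = 1 := by
  simp [wilsonFinTorusPartition]

/-- **`F_β(L) = −log(1 − δᶜ_β(L)) ≤ (4/9) · L³ t · 2^{−k}` inside the door** (`0 ≤ β`, `216 · N · β ≤ 1`, `t` the short
time extent, `2k + 2 < L`, `2k + 2 < t`): integrate the derivative bound `abs_actionDefect_le` from `F_0 = 0`
(mean value inequality) and use `96 N β ≤ 96/216 = 4/9`. -/
theorem negLogColdRatio_le (r : LatticeRep G) {β : ℝ} (h0 : 0 ≤ β) (hβ : 216 * (r.N : ℝ) * β ≤ 1) {L t k : ℕ}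
    [NeZero L] [NeZero t] [NeZero (2 * t)] (hL : 2 * k + 2 < L) (ht : 2 * k + 2 < t) :
    -Real.log (wilsonFinTorusPartition r.ρ β L L L (2 * t) / wilsonFinTorusPartition r.ρ β L L L t ^ 2) ≤
      4 / 9 * (((L * L * L * t : ℕ) : ℝ) * (1 / 2 : ℝ) ^ k) := by
  set C : ℝ := ((L * L * L * (2 * t) : ℕ) : ℝ) * 6 * (8 * r.N * (1 / 2 : ℝ) ^ k) with hC
  set F : ℝ → ℝ := fun b => -Real.log (wilsonFinTorusPartition r.ρ b L L L (2 * t) /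
    wilsonFinTorusPartition r.ρ b L L L t ^ 2) with hF
  have hF0 : F 0 = 0 := by
    simp only [hF, wilsonFinTorusPartition_zero, one_pow, div_one, Real.log_one, neg_zero]
  have hderiv : ∀ b ∈ Set.Icc (0 : ℝ) β, HasDerivWithinAt F
      (finTorusExpectation r.ρ b (finTorusWilsonAction (n₀ := L) (n₁ := L) (n₂ := L) (n₃ := 2 * t) r.ρ) -
        2 * finTorusExpectation r.ρ b (finTorusWilsonAction (n₀ := L) (n₁ := L) (n₂ := L) (n₃ := t) r.ρ))
      (Set.Icc (0 : ℝ) β) b := fun b _ =>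
    (hasDerivAt_negLogColdRatio r L t b).hasDerivWithinAt
  have hbound : ∀ b ∈ Set.Ico (0 : ℝ) β,
      ‖finTorusExpectation r.ρ b (finTorusWilsonAction (n₀ := L) (n₁ := L) (n₂ := L) (n₃ := 2 * t) r.ρ) -
        2 * finTorusExpectation r.ρ b (finTorusWilsonAction (n₀ := L) (n₁ := L) (n₂ := L) (n₃ := t) r.ρ)‖ ≤ C := by
    intro b hb
    rw [Real.norm_eq_abs]
    refine abs_actionDefect_le r ?_ hL ht
    rw [abs_of_nonneg hb.1]
    have hN : (0 : ℝ) ≤ 216 * r.N := by positivity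
    nlinarith [hb.2, mul_le_mul_of_nonneg_left hb.2.le hN]
  have hmvt := norm_image_sub_le_of_norm_deriv_le_segment' hderiv hbound β
    (Set.right_mem_Icc.2 h0)
  rw [hF0, sub_zero, Real.norm_eq_abs] at hmvt
  have hFle : F β ≤ C * β := (le_abs_self _).trans (by simpa using hmvt)
  have hCβ : C * β ≤ 4 / 9 * (((L * L * L * t : ℕ) : ℝ) * (1 / 2 : ℝ) ^ k) := by
    rw [hC]
    have hNβ : (r.N : ℝ) * β ≤ 1 / 216 := by nlinarith
    have hV : (0 : ℝ) ≤ ((L * L * L * t : ℕ) : ℝ) * (1 / 2 : ℝ) ^ k := by positivity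
    have : ((L * L * L * (2 * t) : ℕ) : ℝ) * 6 * (8 * r.N * (1 / 2 : ℝ) ^ k) * β =
        96 * ((r.N : ℝ) * β) * (((L * L * L * t : ℕ) : ℝ) * (1 / 2 : ℝ) ^ k) := by
      push_cast; ring
    rw [this]
    nlinarith [mul_le_mul_of_nonneg_right hNβ hV]
  exact hFle.trans hCβ

/-- **COLD PURITY CORNER AT THE DOBRUSHIN DOOR (every compact group).**  For every lattice representation `r`
(dimension `N`) of a compact metrisable group `G`, every coupling `0 ≤ β` with `216 · N · β ≤ 1` (the tree's
total-variation Dobrushin door; `SU(2)`: `β_W ≤ 1/216`) and every side `L ≥ 20`: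
`δᶜ_β(L) ≤ (4/9) · L³ · ⌊L/4⌋ · 2^{−⌊(⌊L/4⌋ − 3)/2⌋}` — the one-point torus-size difference of the plaquette density is
exponentially small in the window depth (Dobrushin influence), the coupling derivative of `F = −log(1 − δᶜ)` is the sum of
`6 L³ · 2⌊L/4⌋` such differences, `F_0 = 0`, and `δᶜ = 1 − e^{−F} ≤ F`.  (FINITE-BOX-PURITY §9 row (i-f), tier A of
`Cruxes/IR/PURITY-CORNER-TRANSPORT-idea3g13.md`; a FORMAT rung: strong coupling only, group-blind, no bearing on the
weak-coupling content of `ColdExitAt` / `BalabanLadder.IR`.) -/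
theorem coldDefect_le_of_dobrushinTV (r : LatticeRep G) {β : ℝ} (h0 : 0 ≤ β) (hβ : 216 * (r.N : ℝ) * β ≤ 1)
    {L : ℕ} (hL : 20 ≤ L) :
    coldDefect r.ρ β L ≤
      4 / 9 * (((L * L * L * (L / 4) : ℕ) : ℝ) * (1 / 2 : ℝ) ^ (((L / 4) - 3) / 2)) := by
  haveI : NeZero L := ⟨by omega⟩
  haveI : NeZero (L / 4) := ⟨by omega⟩
  haveI : NeZero (2 * (L / 4)) := ⟨by omega⟩
  haveI := r.secondCountableTopology
  have hk1 : 2 * ((L / 4 - 3) / 2) + 2 < L := by omega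
  have hk2 : 2 * ((L / 4 - 3) / 2) + 2 < L / 4 := by omega
  have hF := negLogColdRatio_le r h0 hβ (t := L / 4) hk1 hk2
  have hpos : 0 < wilsonFinTorusPartition r.ρ β L L L (2 * (L / 4)) / wilsonFinTorusPartition r.ρ β L L L (L / 4) ^ 2 :=
    div_pos (wilsonFinTorusPartition_pos r.continuous β L L L _)
      (pow_pos (wilsonFinTorusPartition_pos r.continuous β L L L _) 2)
  unfold coldDefect
  have hexp : wilsonFinTorusPartition r.ρ β L L L (2 * (L / 4)) / wilsonFinTorusPartition r.ρ β L L L (L / 4) ^ 2 =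
      Real.exp (-(-Real.log (wilsonFinTorusPartition r.ρ β L L L (2 * (L / 4)) /
        wilsonFinTorusPartition r.ρ β L L L (L / 4) ^ 2))) := by
    rw [neg_neg, Real.exp_log hpos]
  rw [hexp]
  have h1 := Real.add_one_le_exp (-(-Real.log (wilsonFinTorusPartition r.ρ β L L L (2 * (L / 4)) /
    wilsonFinTorusPartition r.ρ β L L L (L / 4) ^ 2)))
  linarith

/-- The majorant `(4/9) · L³ ⌊L/4⌋ · 2^{−⌊(⌊L/4⌋−3)/2⌋}` is eventually below every `θ > 0`, with an EXPLICIT group-free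
threshold (polynomial times geometric decay in `⌊L/8⌋`). -/
theorem dobrushinMajorant_eventually_le {θ : ℝ} (hθ : 0 < θ) :
    ∃ L₀ : ℕ, ∀ L : ℕ, L₀ ≤ L →
      4 / 9 * (((L * L * L * (L / 4) : ℕ) : ℝ) * (1 / 2 : ℝ) ^ (((L / 4) - 3) / 2)) ≤ θ := by
  -- `b j = (4/9) 8⁴ (j+1)⁴ · 4 · (1/2)^j → 0`
  have hlim : Tendsto (fun j : ℕ => ((j + 1 : ℕ) : ℝ) ^ 4 * (1 / 2 : ℝ) ^ (j + 1)) atTop (𝓝 0) :=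
    (tendsto_pow_const_mul_const_pow_of_abs_lt_one 4
      (by rw [abs_of_pos (by norm_num : (0 : ℝ) < 1 / 2)]; norm_num)).comp (tendsto_add_atTop_nat 1)
  have hlim' : Tendsto (fun j : ℕ => 4 / 9 * 8 ^ 4 * 4 * 2 * (((j + 1 : ℕ) : ℝ) ^ 4 * (1 / 2 : ℝ) ^ (j + 1)))
      atTop (𝓝 (4 / 9 * 8 ^ 4 * 4 * 2 * 0)) := hlim.const_mul _
  rw [mul_zero] at hlim'
  obtain ⟨j₀, hj₀⟩ := eventually_atTop.1 ((tendsto_order.1 hlim').2 θ hθ)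
  refine ⟨8 * j₀, fun L hL => ?_⟩
  set j : ℕ := L / 8 with hj
  have hjj : j₀ ≤ j := by omega
  have hb := (hj₀ j hjj).le
  -- compare the majorant with `b j`
  have hLj : (L : ℝ) ≤ 8 * ((j + 1 : ℕ) : ℝ) := by
    have : L ≤ 8 * (j + 1) := by omega
    exact_mod_cast this
  have ht : ((L / 4 : ℕ) : ℝ) ≤ L := by exact_mod_cast Nat.div_le_self L 4
  have hk : (1 / 2 : ℝ) ^ (((L / 4) - 3) / 2) ≤ 4 * 2 * (1 / 2 : ℝ) ^ (j + 1) := by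
    have hle : j + 1 ≤ ((L / 4) - 3) / 2 + 3 := by omega
    have h1 : (1 / 2 : ℝ) ^ (((L / 4) - 3) / 2 + 3) ≤ (1 / 2 : ℝ) ^ (j + 1) :=
      pow_le_pow_of_le_one (by norm_num) (by norm_num) hle
    have h2 : (1 / 2 : ℝ) ^ (((L / 4) - 3) / 2) = 8 * (1 / 2 : ℝ) ^ (((L / 4) - 3) / 2 + 3) := by
      rw [pow_add]; ring
    rw [h2]; linarith
  have hL0 : (0 : ℝ) ≤ L := Nat.cast_nonneg _
  have hvol : ((L * L * L * (L / 4) : ℕ) : ℝ) ≤ (8 * ((j + 1 : ℕ) : ℝ)) ^ 4 := by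
    rw [Nat.cast_mul, Nat.cast_mul, Nat.cast_mul]
    have ht' : ((L / 4 : ℕ) : ℝ) ≤ 8 * ((j + 1 : ℕ) : ℝ) := ht.trans hLj
    have h3 : (L : ℝ) * L * L ≤ (8 * ((j + 1 : ℕ) : ℝ)) ^ 3 := by
      have := pow_le_pow_left₀ hL0 hLj 3
      nlinarith [this]
    calc (L : ℝ) * L * L * ((L / 4 : ℕ) : ℝ) ≤ (8 * ((j + 1 : ℕ) : ℝ)) ^ 3 * (8 * ((j + 1 : ℕ) : ℝ)) :=
          mul_le_mul h3 ht' (Nat.cast_nonneg _) (by positivity)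
      _ = (8 * ((j + 1 : ℕ) : ℝ)) ^ 4 := by ring
  have hpk : (0 : ℝ) ≤ (1 / 2 : ℝ) ^ (((L / 4) - 3) / 2) := by positivity
  calc 4 / 9 * (((L * L * L * (L / 4) : ℕ) : ℝ) * (1 / 2 : ℝ) ^ (((L / 4) - 3) / 2))
      ≤ 4 / 9 * ((8 * ((j + 1 : ℕ) : ℝ)) ^ 4 * (4 * 2 * (1 / 2 : ℝ) ^ (j + 1))) := by
        gcongr
    _ = 4 / 9 * 8 ^ 4 * 4 * 2 * (((j + 1 : ℕ) : ℝ) ^ 4 * (1 / 2 : ℝ) ^ (j + 1)) := by ring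
    _ ≤ θ := hb

/-- **UNIFORM COLD-PURITY CORNER AT THE DOBRUSHIN DOOR** — the shape of `ColdPurityBridge.coldExit_uniform_of_strongCoupling`
with `strongCouplingRadius r.ρ` replaced by the door `1/(216 N)` and tori of EVERY side `L ≥ L₀`: for every `θ > 0` there
is a GROUP-FREE `L₀` such that for every compact metrisable `G`, every lattice representation `r`, every
`0 ≤ β ≤ 1/(216 N)` and every `L ≥ L₀`, `δᶜ_β(L) ≤ θ`.  (FORMAT rung; opposite corner to `ColdExitAt θ`'s
`∀ β ≥ β₁ ∃ L`.) -/
theorem coldExitAt_corner_of_dobrushinTV {θ : ℝ} (hθ : 0 < θ) :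
    ∃ L₀ : ℕ, ∀ (G : Type) [Group G] [TopologicalSpace G] [IsTopologicalGroup G] [CompactSpace G]
      [MeasurableSpace G] [BorelSpace G] (r : LatticeRep G) (β : ℝ), 0 ≤ β → 216 * (r.N : ℝ) * β ≤ 1 →
      ∀ L : ℕ, L₀ ≤ L → coldDefect r.ρ β L ≤ θ := by
  obtain ⟨L₀, hL₀⟩ := dobrushinMajorant_eventually_le hθ
  refine ⟨max L₀ 20, fun G _ _ _ _ _ _ r β h0 hβ L hL => ?_⟩
  exact (coldDefect_le_of_dobrushinTV r h0 hβ (le_trans (le_max_right _ _) hL)).trans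
    (hL₀ L (le_trans (le_max_left _ _) hL))

end Assembly

end Summit.QuantumFields.YangMills.Cruxes.IR.ColdPurityDobrushin

end
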